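import Summits.SmoothPoincare4.SmoothPoincare4.Theorems.SblfDescentRungOneHelperCollarFlowsAux2
import HarnessLib

/-!
# Rigid collar coordinates, flows III: the coordinates of a map into `S²`, their differentials,
# tangency and the lifting of base vectors

Auxiliary file for the sub-bricks `helper_collar_flowV`, `helper_collar_flowW` (layer (F) "flows"
of the registered stub `helper_sliceGluing_rigidCollar`, apex brick F2-collar), line `Sketch`,
crux `SblfDescent.RungOne`.

(Crux item stmt-SmoothPoincare4-18531; skeleton `Cruxes/RungOne/Lines/Sketch.lean`.)

For a `C^∞` map `f : X⁴ → S² ⊆ ℝ³` we record its position vector `collarPos f : X → ℝ³`, its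
coordinates `collarCrd f i` and their differentials `collarDcrd f i x : ℝ⁴ →L ℝ` (typed as linear
forms on the model space), and prove:

* `mfderiv_apply_eq_of_curve` — the differential of a real function applied to the velocity of a
  curve is the derivative of the function along the curve (chain rule, uniqueness);
* `sum_collarCrd_mul_collarDcrd` — **tangency**: `Σᵢ Fᵢ dFᵢ(w) = 0` (the range of `d(coe)` is
  `(f x)ᗮ`, Mathlib's `range_mfderiv_coe_sphere`);
* `exists_collarDcrd_eq`, `surjective_collarDGp`, `surjective_collarDcrd_two` — at a point where
  `df` is onto, `(dF₀, dF₁)` is onto off the equator and `dF₂` is onto off the poles and the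
  equator: the algebraic input for lifting the base fields (Bröcker–Jänich 1982, proof of (8.12))
  through the planar pair `collarGp f = (F₀, F₁)`;
* two analytic preliminaries for the radial field (`hasDerivAt_sqrt_profile`,
  `eventually_radE_mem`).

Everything here is proved; the `def`s are explicit abbreviations; no named fact is introduced.

## References

* Th. Bröcker, K. Jänich, *Introduction to Differential Topology* (1982), (8.12).
  [BrockerJanichIDT1982]
* J. M. Lee, *Introduction to Smooth Manifolds*, 2nd ed. (2013), Thm. 9.12. [LeeSmoothManifolds2013]
-/

set_option linter.dupNamespace false

noncomputable section

open scoped Manifold ContDiff Topology RealInnerProductSpace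
open Set Function Bundle Literature.Topology.FourManifolds

namespace Summit.SmoothPoincare4.SmoothPoincare4.Cruxes.RungOne.Sketch

/-- Local notation: `𝔼 n` is the model Euclidean space `EuclideanSpace ℝ (Fin n)`. -/
local notation "𝔼 " n:arg => EuclideanSpace ℝ (Fin n)

attribute [local instance] Literature.Topology.FourManifolds.fact_finrank_euclideanSpace_succ

/-! ### Derivatives along curves -/

section Curve

-- tangent spaces are model spaces by definition
set_option backward.isDefEq.respectTransparency false

variable {E : Type*} [NormedAddCommGroup E] [NormedSpace ℝ E] {H : Type*} [TopologicalSpace H]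
  {I : ModelWithCorners ℝ E H} {P : Type*} [TopologicalSpace P] [ChartedSpace H P]

/-- **The differential along a curve**: if `γ` has velocity `V` at time `0`, `γ 0 = x`, `φ` is
differentiable at `x` and the real function `φ ∘ γ` has derivative `d` at `0`, then
`dφₓ(V) = d` (chain rule and uniqueness of derivatives). [folklore] -/
theorem mfderiv_apply_eq_of_curve {γ : ℝ → P} {x : P} {V : TangentSpace I x} {φ : P → ℝ} {d : ℝ}
    (hγ : HasMFDerivAt 𝓘(ℝ, ℝ) I γ 0 ((1 : ℝ →L[ℝ] ℝ).smulRight V)) (h0 : γ 0 = x)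
    (hφ : MDifferentiableAt I 𝓘(ℝ, ℝ) φ x) (hd : HasDerivAt (φ ∘ γ) d 0) :
    mfderiv I 𝓘(ℝ, ℝ) φ x V = d := by
  subst h0
  have hc : HasMFDerivAt 𝓘(ℝ, ℝ) 𝓘(ℝ, ℝ) (φ ∘ γ) 0
      ((mfderiv I 𝓘(ℝ, ℝ) φ (γ 0)).comp ((1 : ℝ →L[ℝ] ℝ).smulRight V)) :=
    hφ.hasMFDerivAt.comp 0 hγ
  rw [hasMFDerivAt_iff_hasFDerivAt] at hc
  have h1 := hc.hasDerivAt
  have h2 : ((mfderiv I 𝓘(ℝ, ℝ) φ (γ 0)).comp ((1 : ℝ →L[ℝ] ℝ).smulRight V)) 1 =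
      mfderiv I 𝓘(ℝ, ℝ) φ (γ 0) V := by
    simp only [ContinuousLinearMap.coe_comp, comp_apply, ContinuousLinearMap.smulRight_apply,
      one_apply_eq_self, one_smul]
  exact (h1.congr_deriv h2).unique hd

end Curve

/-! ### Coordinates of a map into `S²` and their differentials -/

section SphereCoords

-- tangent spaces are model spaces by definition
set_option backward.isDefEq.respectTransparency false

variable {X : Type*} [TopologicalSpace X] [ChartedSpace (𝔼 4) X]
  {f : X → Metric.sphere (0 : 𝔼 3) 1}

/-- The position vector `F x ∈ ℝ³` of `f x ∈ S²`. [folklore] -/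
def collarPos (f : X → Metric.sphere (0 : 𝔼 3) 1) (x : X) : 𝔼 3 :=
  ((f x : Metric.sphere (0 : 𝔼 3) 1) : 𝔼 3)

/-- The coordinates `F_i : X → ℝ` of a map into `S² ⊆ ℝ³`. [folklore] -/
def collarCrd (f : X → Metric.sphere (0 : 𝔼 3) 1) (i : Fin 3) (x : X) : ℝ := collarPos f x i

omit [TopologicalSpace X] [ChartedSpace (𝔼 4) X] in
/-- Unfolding lemma. [folklore] -/
theorem collarCrd_apply (f : X → Metric.sphere (0 : 𝔼 3) 1) (i : Fin 3) (x : X) :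
    collarCrd f i x = ((f x : Metric.sphere (0 : 𝔼 3) 1) : 𝔼 3) i := rfl

/-- The differential of the position vector, typed as a linear map `ℝ⁴ → ℝ³`. [folklore] -/
def collarDpos (f : X → Metric.sphere (0 : 𝔼 3) 1) (x : X) : 𝔼 4 →L[ℝ] 𝔼 3 :=
  mfderiv (𝓡 4) 𝓘(ℝ, 𝔼 3) (collarPos f) x

/-- The differential of a coordinate, typed as a linear form on `ℝ⁴`. [folklore] -/
def collarDcrd (f : X → Metric.sphere (0 : 𝔼 3) 1) (i : Fin 3) (x : X) : 𝔼 4 →L[ℝ] ℝ :=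
  mfderiv (𝓡 4) 𝓘(ℝ, ℝ) (collarCrd f i) x

/-- Unfolding lemma. [folklore] -/
theorem collarDcrd_def (f : X → Metric.sphere (0 : 𝔼 3) 1) (i : Fin 3) (x : X) :
    collarDcrd f i x = mfderiv (𝓡 4) 𝓘(ℝ, ℝ) (collarCrd f i) x := rfl

omit [TopologicalSpace X] [ChartedSpace (𝔼 4) X] in
/-- `Σᵢ Fᵢ² = 1`. [folklore] -/
theorem sum_collarCrd_sq (f : X → Metric.sphere (0 : 𝔼 3) 1) (x : X) :
    collarCrd f 0 x ^ 2 + collarCrd f 1 x ^ 2 + collarCrd f 2 x ^ 2 = 1 := by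
  have h : ‖collarPos f x‖ = 1 := norm_eq_of_mem_sphere (f x)
  have h' : ‖collarPos f x‖ ^ 2 = 1 := by rw [h, one_pow]
  rw [EuclideanSpace.norm_sq_eq, Fin.sum_univ_three] at h'
  simp only [collarCrd]
  simpa only [Real.norm_eq_abs, sq_abs] using h'


/-- The position vector is smooth. [folklore] -/
theorem contMDiff_collarPos (hf : ContMDiff (𝓡 4) (𝓡 2) ∞ f) :
    ContMDiff (𝓡 4) 𝓘(ℝ, 𝔼 3) ∞ (collarPos f) :=
  contMDiff_coe_sphere.comp hf

/-- The coordinates are smooth. [folklore] -/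
theorem contMDiff_collarCrd (hf : ContMDiff (𝓡 4) (𝓡 2) ∞ f) (i : Fin 3) :
    ContMDiff (𝓡 4) 𝓘(ℝ, ℝ) ∞ (collarCrd f i) :=
  ((EuclideanSpace.proj i).contDiff.comp_contMDiff (contMDiff_collarPos hf) :)

/-- The coordinates are differentiable. [folklore] -/
theorem mdifferentiableAt_collarCrd (hf : ContMDiff (𝓡 4) (𝓡 2) ∞ f) (i : Fin 3) (x : X) :
    MDifferentiableAt (𝓡 4) 𝓘(ℝ, ℝ) (collarCrd f i) x :=
  (contMDiff_collarCrd hf i).mdifferentiableAt (by simp)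

/-- **The differential of a coordinate is the coordinate of the differential** of the position
vector: `dFᵢ(w) = (dF(w))ᵢ`. [folklore] -/
theorem collarDcrd_apply (hf : ContMDiff (𝓡 4) (𝓡 2) ∞ f) (i : Fin 3) (x : X) (w : 𝔼 4) :
    collarDcrd f i x w = collarDpos f x w i := by
  have h : HasMFDerivAt (𝓡 4) 𝓘(ℝ, ℝ) (collarCrd f i) x
      ((EuclideanSpace.proj i : 𝔼 3 →L[ℝ] ℝ).comp (collarDpos f x)) :=
    ((EuclideanSpace.proj i : 𝔼 3 →L[ℝ] ℝ).hasMFDerivAt).comp x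
      (((contMDiff_collarPos hf).mdifferentiableAt (by simp)).hasMFDerivAt)
  rw [collarDcrd, h.mfderiv]
  rfl

/-- The differential of the inclusion `S² ⊆ ℝ³` at `f x`, typed as a linear map `ℝ² → ℝ³`.
[folklore] -/
def collarDval (f : X → Metric.sphere (0 : 𝔼 3) 1) (x : X) : 𝔼 2 →L[ℝ] 𝔼 3 :=
  mfderiv (𝓡 2) 𝓘(ℝ, 𝔼 3) ((↑) : Metric.sphere (0 : 𝔼 3) 1 → 𝔼 3) (f x)

omit [TopologicalSpace X] [ChartedSpace (𝔼 4) X] in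
/-- The range of `d(coe)` at `f x` is `(f x)ᗮ` (Mathlib's `range_mfderiv_coe_sphere`). [folklore] -/
theorem range_collarDval (f : X → Metric.sphere (0 : 𝔼 3) 1) (x : X) :
    LinearMap.range (collarDval f x : 𝔼 2 →ₗ[ℝ] 𝔼 3) = (ℝ ∙ (collarPos f x))ᗮ :=
  range_mfderiv_coe_sphere (f x)

/-- `dF = d(coe) ∘ df`. [folklore] -/
theorem collarDpos_eq_comp (hf : ContMDiff (𝓡 4) (𝓡 2) ∞ f) (x : X) :
    collarDpos f x = (collarDval f x).comp (mfderiv (𝓡 4) (𝓡 2) f x) :=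
  mfderiv_comp x ((contMDiff_coe_sphere (f x)).mdifferentiableAt one_ne_zero)
    (hf.mdifferentiableAt (by simp))

/-- **The differential of the position vector is tangent to the sphere**: its values lie in
`(f x)ᗮ`, the range of `d(coe)`. [folklore] -/
theorem collarDpos_apply_mem_orthogonal (hf : ContMDiff (𝓡 4) (𝓡 2) ∞ f) (x : X) (w : 𝔼 4) :
    collarDpos f x w ∈ (ℝ ∙ (collarPos f x))ᗮ := by
  have h : collarDpos f x w ∈ LinearMap.range (collarDval f x : 𝔼 2 →ₗ[ℝ] 𝔼 3) := by
    rw [collarDpos_eq_comp hf]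
    exact ⟨_, rfl⟩
  rwa [range_collarDval] at h

/-- **Tangency in coordinates**: `Σᵢ Fᵢ(x) · dFᵢ(w) = 0`. [folklore] -/
theorem sum_collarCrd_mul_collarDcrd (hf : ContMDiff (𝓡 4) (𝓡 2) ∞ f) (x : X) (w : 𝔼 4) :
    collarCrd f 0 x * collarDcrd f 0 x w + collarCrd f 1 x * collarDcrd f 1 x w + collarCrd f 2 x * collarDcrd f 2 x w = 0 := by
  have h := Submodule.mem_orthogonal_singleton_iff_inner_right.1 (collarDpos_apply_mem_orthogonal hf x w)
  rw [PiLp.inner_apply, Fin.sum_univ_three] at h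
  simp only [RCLike.inner_apply, conj_trivial] at h
  rw [collarDcrd_apply hf, collarDcrd_apply hf, collarDcrd_apply hf]
  simp only [collarCrd]
  linarith

/-- **`dF` hits every vector of `(f x)ᗮ` when `df` is onto**: for `a, b ∈ ℝ` and `(f x)₂ ≠ 0`
there is `w` with `dF₀(w) = a`, `dF₁(w) = b`. [folklore] -/
theorem exists_collarDcrd_eq (hf : ContMDiff (𝓡 4) (𝓡 2) ∞ f) {x : X}
    (hsurj : Surjective (mfderiv (𝓡 4) (𝓡 2) f x)) (h2 : collarCrd f 2 x ≠ 0) (a b : ℝ) :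
    ∃ w : 𝔼 4, collarDcrd f 0 x w = a ∧ collarDcrd f 1 x w = b := by
  set y : 𝔼 3 := collarPos f x with hy
  set z : 𝔼 3 := !₂[a, b, -(y 0 * a + y 1 * b) / y 2] with hz
  have hz0 : z 0 = a := by simp [hz]
  have hz1 : z 1 = b := by simp [hz]
  have hz2 : z 2 = -(y 0 * a + y 1 * b) / y 2 := by simp [hz]
  have hzmem : z ∈ (ℝ ∙ y)ᗮ := by
    rw [Submodule.mem_orthogonal_singleton_iff_inner_right, PiLp.inner_apply, Fin.sum_univ_three]
    simp only [RCLike.inner_apply, conj_trivial, hz0, hz1, hz2]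
    have h2' : y 2 ≠ 0 := h2
    field_simp
    ring
  have hrange : z ∈ LinearMap.range (collarDval f x : 𝔼 2 →ₗ[ℝ] 𝔼 3) := by rw [range_collarDval]; exact hzmem
  obtain ⟨t, ht⟩ := hrange
  obtain ⟨w, rfl⟩ := hsurj t
  have hcomp : collarDpos f x w = z := by rw [collarDpos_eq_comp hf]; exact ht
  exact ⟨w, by rw [collarDcrd_apply hf, hcomp, hz0], by rw [collarDcrd_apply hf, hcomp, hz1]⟩

/-- **The planar pair** `G = (F₀, F₁) : X → ℝ²`, through which the base fields are lifted.
[folklore] -/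
def collarGp (f : X → Metric.sphere (0 : 𝔼 3) 1) (x : X) : ℝ × ℝ := (collarCrd f 0 x, collarCrd f 1 x)

omit [TopologicalSpace X] [ChartedSpace (𝔼 4) X] in
/-- Unfolding lemma. [folklore] -/
theorem collarGp_apply (f : X → Metric.sphere (0 : 𝔼 3) 1) (x : X) : collarGp f x = (collarCrd f 0 x, collarCrd f 1 x) := rfl

/-- `G` is smooth. [folklore] -/
theorem contMDiff_collarGp (hf : ContMDiff (𝓡 4) (𝓡 2) ∞ f) : ContMDiff (𝓡 4) 𝓘(ℝ, ℝ × ℝ) ∞ (collarGp f) :=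
  (contMDiff_collarCrd hf 0).prodMk_space (contMDiff_collarCrd hf 1)

/-- The differential of `G`, typed as a linear map `ℝ⁴ → ℝ²`. [folklore] -/
def collarDGp (f : X → Metric.sphere (0 : 𝔼 3) 1) (x : X) : 𝔼 4 →L[ℝ] ℝ × ℝ :=
  mfderiv (𝓡 4) 𝓘(ℝ, ℝ × ℝ) (collarGp f) x

/-- Unfolding lemma. [folklore] -/
theorem collarDGp_def (f : X → Metric.sphere (0 : 𝔼 3) 1) (x : X) :
    collarDGp f x = mfderiv (𝓡 4) 𝓘(ℝ, ℝ × ℝ) (collarGp f) x := rfl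

/-- **The differential of `G` is the pair of the differentials of `F₀`, `F₁`.** [folklore] -/
theorem collarDGp_apply (hf : ContMDiff (𝓡 4) (𝓡 2) ∞ f) (x : X) (w : 𝔼 4) :
    collarDGp f x w = (collarDcrd f 0 x w, collarDcrd f 1 x w) := by
  have hL : HasMFDerivAt (𝓡 4) 𝓘(ℝ, ℝ × ℝ) (collarGp f) x
      ((((EuclideanSpace.proj (0 : Fin 3) : 𝔼 3 →L[ℝ] ℝ).prod
        (EuclideanSpace.proj (1 : Fin 3) : 𝔼 3 →L[ℝ] ℝ))).comp (collarDpos f x)) :=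
    (((EuclideanSpace.proj (0 : Fin 3) : 𝔼 3 →L[ℝ] ℝ).prod
      (EuclideanSpace.proj (1 : Fin 3) : 𝔼 3 →L[ℝ] ℝ)).hasMFDerivAt).comp x
      (((contMDiff_collarPos hf).mdifferentiableAt (by simp)).hasMFDerivAt)
  rw [collarDGp, hL.mfderiv, collarDcrd_apply hf, collarDcrd_apply hf]
  rfl

/-- **`dG` is onto off the equator** at points where `df` is onto. [folklore] -/
theorem surjective_collarDGp (hf : ContMDiff (𝓡 4) (𝓡 2) ∞ f) {x : X}
    (hsurj : Surjective (mfderiv (𝓡 4) (𝓡 2) f x)) (h2 : collarCrd f 2 x ≠ 0) :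
    Surjective (collarDGp f x) := by
  rintro ⟨a, b⟩
  obtain ⟨w, ha, hb⟩ := exists_collarDcrd_eq hf hsurj h2 a b
  exact ⟨w, by rw [collarDGp_apply hf, ha, hb]⟩

/-- **`dF₂` is onto off the poles and the equator** at points where `df` is onto
(`dF₂(w) = -(F₀ dF₀(w) + F₁ dF₁(w))/F₂` can be prescribed since `(F₀, F₁) ≠ 0`). [folklore] -/
theorem surjective_collarDcrd_two (hf : ContMDiff (𝓡 4) (𝓡 2) ∞ f) {x : X}
    (hsurj : Surjective (mfderiv (𝓡 4) (𝓡 2) f x)) (h2 : collarCrd f 2 x ≠ 0)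
    (h2' : collarCrd f 2 x ^ 2 ≠ 1) : Surjective (collarDcrd f 2 x) := by
  have hG : collarCrd f 0 x ^ 2 + collarCrd f 1 x ^ 2 ≠ 0 := by
    intro h; apply h2'; linarith [sum_collarCrd_sq f x]
  intro r
  obtain ⟨w, ha, hb⟩ := exists_collarDcrd_eq hf hsurj h2
    (-r * collarCrd f 2 x * collarCrd f 0 x / (collarCrd f 0 x ^ 2 + collarCrd f 1 x ^ 2))
    (-r * collarCrd f 2 x * collarCrd f 1 x / (collarCrd f 0 x ^ 2 + collarCrd f 1 x ^ 2))
  refine ⟨w, ?_⟩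
  have h := sum_collarCrd_mul_collarDcrd hf x w
  rw [ha, hb] at h
  have h3 : collarCrd f 2 x * collarDcrd f 2 x w = collarCrd f 2 x * r := by
    have : collarCrd f 0 x * (-r * collarCrd f 2 x * collarCrd f 0 x / (collarCrd f 0 x ^ 2 + collarCrd f 1 x ^ 2)) +
        collarCrd f 1 x * (-r * collarCrd f 2 x * collarCrd f 1 x / (collarCrd f 0 x ^ 2 + collarCrd f 1 x ^ 2)) =
        -(collarCrd f 2 x * r) := by
      field_simp; ring
    linarith
  exact mul_left_cancel₀ h2 h3

end SphereCoords

/-! ### Two analytic preliminaries for the radial field -/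

section RadialPrelim

/-- The scalar profile `t ↦ √(1 - (Q + t)²)` has derivative `-Q/√(1 - Q²)` at `0` (`Q² < 1`).
[folklore] -/
theorem hasDerivAt_sqrt_profile {Q : ℝ} (hQ : Q ^ 2 < 1) :
    HasDerivAt (fun t : ℝ => √(1 - (Q + t) ^ 2)) (-Q / √(1 - Q ^ 2)) 0 := by
  have h1 : HasDerivAt (fun t : ℝ => 1 - (Q + t) ^ 2) (-(2 * (Q + 0) ^ 1 * 1)) 0 := by
    have := (((hasDerivAt_id (0 : ℝ)).const_add Q).pow 2).const_sub 1
    simpa using this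
  have h2 := h1.sqrt (by rw [add_zero]; exact (sub_pos.2 hQ).ne')
  convert h2 using 1
  simp only [add_zero, pow_one, mul_one]
  field_simp

/-- Near `t = 0` the radial model curve stays in the tube off the axis. [folklore] -/
theorem eventually_radE_mem {ε : ℝ} {ξ : 𝔼 3}
    (hξ : ξ ∈ Metric.ball (0 : 𝔼 3) ε) (hm : 0 < mE ξ) :
    ∀ᶠ t in 𝓝 (0 : ℝ), 0 < mE ξ + t ∧ radE t ξ ∈ Metric.ball (0 : 𝔼 3) ε := by
  have hm0 : ((0 : ℝ), ξ) ∈ {q : ℝ × 𝔼 3 | 0 < mE q.2 ∧ 0 < mE q.2 + q.1} :=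
    ⟨hm, by simpa using hm⟩
  have h2 : ContinuousAt (fun q : ℝ × 𝔼 3 => radE q.1 q.2) ((0 : ℝ), ξ) :=
    (contDiffOn_radE.continuousOn.continuousWithinAt hm0).continuousAt
      (isOpen_radDomE.mem_nhds hm0)
  have hc : ContinuousAt (fun t : ℝ => radE t ξ) 0 :=
    (h2.comp (f := fun t : ℝ => ((t, ξ) : ℝ × 𝔼 3))
      (continuous_id.prodMk continuous_const).continuousAt :)
  have h1 : ∀ᶠ t in 𝓝 (0 : ℝ), 0 < mE ξ + t :=
    (continuous_const.add continuous_id).continuousAt.eventually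
      (isOpen_Ioi.mem_nhds (by simpa using hm))
  have h3 : ∀ᶠ t in 𝓝 (0 : ℝ), radE t ξ ∈ Metric.ball (0 : 𝔼 3) ε :=
    hc.preimage_mem_nhds (Metric.isOpen_ball.mem_nhds (by simpa [radE_zero hm] using hξ))
  exact h1.and h3

end RadialPrelim


end Summit.SmoothPoincare4.SmoothPoincare4.Cruxes.RungOne.Sketch

end
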